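import Summits.QuantumFields.YangMills.Theorems.UnitScaleTiltFluctuationComparisonRegPrGlobalSlackCanonicalPolymersCoreSizes
import HarnessLib

/-!
# `UnitScaleTiltFluctuationComparisonRegPrGlobalSlackStepFarTheta` — THE DISPLAYED FAR ROW OF A STEP RECORD IN THE RESIDUAL ROW'S CURRENCY: `|far_X| ≤ C(𝔠, L)·θ(n)⁷·e^{−κ·dj X}`
# at the birth reading `n = K − b − 1`, PER RUN, from G3D-06 `far_le` alone (crux `FluctuationComparisonRegPrIntL`, stmt-QuantumFields-20520, pen v5kC stub 3⁗χ
# `stub_globalTwoRunSlackFamChi`; width seat ym-ust-20520-w3 g0 — the «NEXT NAMED LEMMA FOR w3» of ★ym-ust-20520-w1 g0, STATUS 23:26:05Z; YM₃ on the 3-torus is ladder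
# rung R3, not the Clay problem)

WHY.  ★w1 g0's own-indexed reading of 3⁗χ (`GlobalSlackKernelLeg.K1aLegRowsOwnChi`, p584104) asks, per run, the seventh-order residual row in the shape of
`GlobalSlackKernelLeg.RemainderSmallOwnΦ`: on run `K`'s `θ(n)`-window, at the birth reading (`x = 1`), `|rest| ≤ C_R·e^{−κ𝓛}·θ(n)⁷`.  By ★w1's `canonPTCore_birth_eq` (p585084) the rest
of the canonical term function at the birth level is `−(far_X + far^Λ_X)`.  This file discharges the 𝔖-HALF of that row from the DISPLAYED far row of the core step record ALONE
(`AlphaV3AC.StepAlphaV3CoreAC.far_le` = G3D-06 `FarTermsDecayAsCited far (C25·g_b·e^{−κ dj}) Cfar (g_b⁷(r(g_b)p(g_b))⁷)`), for EVERY history and field (no window needed):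

* §1 bookkeeping on Bałaban's thresholds: `g_mul_rFun_pow_seven_le` (the SPARE coupling of the (25)-amplitude absorbs the collar polylogarithm: `g·r(g)⁷ ≤ tlConst(7r₀, 1)` on
  `(0, 1]`), **`θBal_succ_le_mul`** (`θ(i+1) ≤ (√L)⁻¹·(1 + log √L)^{p₀}·θ(i)`, window-free: `g_{i+1} = g_i/√L` and `1 + log g⁻¹ + log √L ≤ (1 + log g⁻¹)(1 + log √L)`) and
  **`θBal_succ_pow_le`** (the same for `n`-th powers);
* §2 **`abs_stepFar_le_theta7`**: for `b + 1 ≤ K`, every step-`b` domain `X`, history `h` and field `W`,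
  `|((q K).𝔖 b).far X h W| ≤ (Cfar·C25·tlConst(7r₀,1)·((√L)⁻¹(1 + log √L)^{p₀})⁷) · θBal F.L γ b₀ p₀ (K − b − 1)⁷ · e^{−𝔠.κ·dj X}` — via `far_le`, (i) `g·r(g)⁷ ≤ tlConst`,
  (ii) `(g_b p(g_b))⁷ = θBal(K − b)⁷` (`PkgCoreV3.eps1_eq`) and (iii) `θBal(K − b)⁷ ≤ (…)⁷·θBal(K − b − 1)⁷` (one height up, `θBal_succ_pow_le`); also the un-shifted form
  `abs_stepFar_le_theta7_at` (`θBal(K − b)⁷`, constant `Cfar·C25·tlConst(7r₀,1)`).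
LOCATED, NOT TOUCHED (★w1 g0 item (b)): the (61)-born far terms `(𝔄.Λc b).far` carry the g-FREE amplitude `C63·e^{−κ𝓛}` (G3D-07), so `r(g_b)⁷` has no spare coupling to absorb it —
that half of the residual row does NOT follow from the displayed rows at the record's profile and is left as located.  HONEST FRAMING: bookkeeping inequalities from one displayed
row; nothing of [Balaban1985UV3] is asserted; registry untouched (`--supports stmt-QuantumFields-20520`); no claim about the crux, d = 4 or the mass gap.

References: T. Bałaban, CMP 102 (1985) 255–275 [Balaban1985UV3] ((5) p.256, (7) p.257, (25) p.262, p.264 L14–20 (far terms), (57) p.270); C. King, CMP 102 (1986) 649–677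
[King1986] (Thm 3.4 (3.9) p.656).
-/

set_option autoImplicit false

noncomputable section

namespace Summit.QuantumFields.YangMills.Theorems.GlobalSlackCanonicalPolymers

open scoped BigOperators
open Literature.MathematicalPhysics.QuantumFieldTheory.Balaban1983to89
open Literature.MathematicalPhysics.QuantumFieldTheory.Balaban1983to89.T3ContinuumYM3Torus
open Literature.MathematicalPhysics.QuantumFieldTheory.Balaban1983to89.T3UnitScaleTilt (θBal)
open Literature.MathematicalPhysics.QuantumFieldTheory.Balaban1983to89.TreeLengthTorus (tsys)
open Literature.MathematicalPhysics.QuantumFieldTheory.Balaban1985CMP102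
open Literature.MathematicalPhysics.QuantumFieldTheory.Balaban1985CMP102.Setting
open Summit.QuantumFields.Balaban3D.Carriers
open Summit.QuantumFields.Balaban3D.Proofs.Primitives
open Summit.QuantumFields.Balaban3D.Proofs.NewbornJet (tlConst tlConst_nonneg rpow_mul_logpow_le rFun_pow)
open Summit.QuantumFields.Balaban3D.Proofs.ScalesArithmetic (gk_pos gk_le_one)
open Summit.QuantumFields.YangMills.Theorems

/-! ## §1 Threshold bookkeeping: the spare coupling absorbs the collar polylogarithm; `θ` one height up -/

section Thresholds

/-- **THE SPARE COUPLING ABSORBS THE COLLAR POLYLOGARITHM**: `g·r(g)⁷ = g·(1 + log g⁻¹)^{7r₀} ≤ tlConst(7r₀, 1)` on `(0, 1]` for `r₀ > 0` (tangent-line bound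
`NewbornJet.rpow_mul_logpow_le`). [cite: Balaban1985UV3, (7) p.257, (25) p.262] -/
theorem g_mul_rFun_pow_seven_le {r₀ g : ℝ} (hr₀ : 0 < r₀) (hg : 0 < g) (hg1 : g ≤ 1) :
    g * B10.rFun r₀ g ^ 7 ≤ tlConst (7 * r₀) 1 := by
  have hcore := rpow_mul_logpow_le (7 * r₀) 1 g (by linarith) one_pos hg hg1
  rw [Real.rpow_one] at hcore
  have h7 : B10.rFun r₀ g ^ 7 = (1 + Real.log g⁻¹) ^ (7 * r₀) := by
    rw [rFun_pow r₀ g 7 hg hg1]; norm_num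
  rw [h7]
  exact hcore

/-- **`θ` ONE HEIGHT UP, WINDOW-FREE**: `θ(i+1) ≤ (√L)⁻¹·(1 + log √L)^{p₀}·θ(i)` for `L ≥ 1`, `0 < γ ≤ 1`, `b₀, p₀ ≥ 0` — since `g_{i+1} = g_i/√L` and
`p(g_{i+1}) = b₀(1 + log g_i⁻¹ + log √L)^{p₀} ≤ b₀((1 + log g_i⁻¹)(1 + log √L))^{p₀}`. [cite: Balaban1985UV3, (5) p.256, (7) p.257] -/
theorem θBal_succ_le_mul {L : ℕ} (hL : 1 ≤ L) {γ b₀ p₀ : ℝ} (hγ : 0 < γ) (hγ1 : γ ≤ 1) (hb : 0 ≤ b₀) (hp : 0 ≤ p₀) (i : ℕ) :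
    θBal L γ b₀ p₀ (i + 1) ≤ (Real.sqrt L)⁻¹ * (1 + Real.log (Real.sqrt L)) ^ p₀ * θBal L γ b₀ p₀ i := by
  have hL0 : (0 : ℝ) < L := by exact_mod_cast (show 0 < L by omega)
  have hL1 : (1 : ℝ) ≤ L := by exact_mod_cast hL
  set g : ℝ := Real.sqrt (γ * ((L : ℝ)⁻¹) ^ i) with hgdef
  have hx0 : 0 ≤ γ * ((L : ℝ)⁻¹) ^ i := by positivity
  have hg0 : 0 < g := Real.sqrt_pos.2 (by positivity)
  have hg1 : g ≤ 1 := T3Thresholds.coupling_le_one hL hγ hγ1 i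
  have hsL : 0 < Real.sqrt L := Real.sqrt_pos.2 hL0
  have hsL1 : 1 ≤ Real.sqrt L := by rw [← Real.sqrt_one]; exact Real.sqrt_le_sqrt hL1
  -- the next coupling
  have hg' : Real.sqrt (γ * ((L : ℝ)⁻¹) ^ (i + 1)) = g * (Real.sqrt L)⁻¹ := by
    rw [pow_succ, ← mul_assoc, Real.sqrt_mul hx0, Real.sqrt_inv]
  -- the logarithms
  set u : ℝ := Real.log g⁻¹ with hudef
  set s : ℝ := Real.log (Real.sqrt L) with hsdef
  have hu : 0 ≤ u := B10.log_inv_nonneg_of_le_one hg0 hg1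
  have hs : 0 ≤ s := Real.log_nonneg hsL1
  have hlog : Real.log (g * (Real.sqrt L)⁻¹)⁻¹ = u + s := by
    rw [mul_inv, inv_inv, Real.log_mul (inv_ne_zero hg0.ne') hsL.ne']
  have hsum : (1 + (u + s)) ^ p₀ ≤ (1 + u) ^ p₀ * (1 + s) ^ p₀ := by
    rw [← Real.mul_rpow (by linarith) (by linarith)]
    exact Real.rpow_le_rpow (by linarith) (by nlinarith) hp
  -- assemble
  rw [T3Thresholds.θBal_eq, T3Thresholds.θBal_eq, hg', ← hgdef]
  unfold B10.pFun
  rw [hlog, ← hudef]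
  have hfac : 0 ≤ g * (Real.sqrt L)⁻¹ * b₀ := by positivity
  calc g * (Real.sqrt ↑L)⁻¹ * (b₀ * (1 + (u + s)) ^ p₀)
      = (g * (Real.sqrt ↑L)⁻¹ * b₀) * (1 + (u + s)) ^ p₀ := by ring
    _ ≤ (g * (Real.sqrt ↑L)⁻¹ * b₀) * ((1 + u) ^ p₀ * (1 + s) ^ p₀) := mul_le_mul_of_nonneg_left hsum hfac
    _ = (Real.sqrt ↑L)⁻¹ * (1 + s) ^ p₀ * (g * (b₀ * (1 + u) ^ p₀)) := by ring

/-- **`θⁿ` ONE HEIGHT UP**: `θ(i+1)ⁿ ≤ ((√L)⁻¹·(1 + log √L)^{p₀})ⁿ·θ(i)ⁿ` (`θBal_succ_le_mul`, `θ ≥ 0`). [cite: Balaban1985UV3, (5) p.256, (7) p.257] -/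
theorem θBal_succ_pow_le {L : ℕ} (hL : 1 ≤ L) {γ b₀ p₀ : ℝ} (hγ : 0 < γ) (hγ1 : γ ≤ 1) (hb : 0 ≤ b₀) (hp : 0 ≤ p₀) (i n : ℕ) :
    θBal L γ b₀ p₀ (i + 1) ^ n ≤ ((Real.sqrt L)⁻¹ * (1 + Real.log (Real.sqrt L)) ^ p₀) ^ n * θBal L γ b₀ p₀ i ^ n := by
  have hθ : 0 ≤ θBal L γ b₀ p₀ (i + 1) := by
    rw [T3Thresholds.θBal_eq]
    exact mul_nonneg (Real.sqrt_nonneg _) (B10.pFun_nonneg _ _ _ hb (Real.sqrt_pos.2 (by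
      have hL0 : (0 : ℝ) < L := by exact_mod_cast (show 0 < L by omega)
      positivity)) (T3Thresholds.coupling_le_one hL hγ hγ1 (i + 1)))
  rw [← mul_pow]
  exact pow_le_pow_left₀ hθ (θBal_succ_le_mul hL hγ hγ1 hb hp i) n

end Thresholds

/-! ## §2 The step record's far terms in the residual row's currency, per run -/

section Far

variable {F : T3Family} {𝔠 : AlphaConsts F.L (suGroupModel 2).N} {γ : ℝ} {hγ : 0 < γ} {hγ1 : γ ≤ (min 𝔠.gamma0 1) ^ 2}

variable (q : ∀ K, AlphaInputsT3AC.PkgCoreV3 F 𝔠 γ hγ hγ1 K)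

/-- **THE STEP RECORD'S FAR TERMS ARE `θ(K − b)⁷`-SMALL** (un-shifted form): for `b + 1 ≤ K`, every step-`b` domain `X`, every history `h` and field `W`,
`|((q K).𝔖 b).far X h W| ≤ Cfar·C25·tlConst(7r₀, 1)·θBal F.L γ b₀ p₀ (K − b)⁷·e^{−κ·dj X}` — the displayed G3D-06 row `far_le` (`Cfar·(C25·g_b·e^{−κ dj})·g_b⁷(r(g_b)p(g_b))⁷`)
with the spare coupling absorbing `r(g_b)⁷` (`g_mul_rFun_pow_seven_le`) and `(g_b p(g_b))⁷ = θ(K − b)⁷` (`PkgCoreV3.eps1_eq`). [cite: Balaban1985UV3, p.264 L14-20, (25) p.262, (7) p.257] -/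
theorem abs_stepFar_le_theta7_at (K b : ℕ) (hb : b + 1 ≤ K) (X : (tsys 3 (nblkOf (SK F 𝔠 γ hγ hγ1 K) 𝔠.lane.carrier b)).Dom)
    (h : Hist (F.P K) (b + 1)) (W : GaugeField (F.P K) (b + 1) (Matrix.specialUnitaryGroup (Fin 2) ℂ)) :
    |((q K).𝔖 b).far X h W| ≤ 𝔠.Cfar * 𝔠.C25 * tlConst (7 * 𝔠.r₀) 1 * θBal F.L γ 𝔠.b₀ 𝔠.p₀ (K - b) ^ 7 *
      Real.exp (-(𝔠.κ * (tsys 3 (nblkOf (SK F 𝔠 γ hγ hγ1 K) 𝔠.lane.carrier b)).dj X)) := by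
  -- letters
  set g : ℝ := (SK F 𝔠 γ hγ hγ1 K).gk b with hgdef
  set pg : ℝ := B10.pFun 𝔠.b₀ 𝔠.p₀ g with hpgdef
  set r : ℝ := B10.rFun 𝔠.r₀ g with hrdef
  set e : ℝ := Real.exp (-(𝔠.κ * (tsys 3 (nblkOf (SK F 𝔠 γ hγ hγ1 K) 𝔠.lane.carrier b)).dj X)) with hedef
  have hg0 : 0 < g := gk_pos _ b
  have hg1 : g ≤ 1 := gk_le_one _ (SK F 𝔠 γ hγ hγ1 K).gK_le_one b (by show b ≤ K; omega)
  have hpg0 : 0 ≤ pg := B10.pFun_nonneg _ _ _ 𝔠.b₀_pos.le hg0 hg1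
  -- the displayed far row
  have hfar : |((q K).𝔖 b).far X h W| ≤ 𝔠.Cfar * ((𝔠.C25 * g * e) * (g ^ 7 * (r * pg) ^ 7)) :=
    ((q K).runCore.steps b hb).far_le X h W
  -- the spare coupling absorbs the polylogarithm
  have hT : g * r ^ 7 ≤ tlConst (7 * 𝔠.r₀) 1 := g_mul_rFun_pow_seven_le (lt_of_lt_of_le one_pos 𝔠.one_le_r₀) hg0 hg1
  -- the window letter
  have heps : g * pg = θBal F.L γ 𝔠.b₀ 𝔠.p₀ (K - b) := (q K).eps1_eq b (by omega)
  have hc : 0 ≤ 𝔠.Cfar * 𝔠.C25 * e * (g * pg) ^ 7 := by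
    have := 𝔠.Cfar_nonneg; have := 𝔠.C25_nonneg; positivity
  calc |((q K).𝔖 b).far X h W| ≤ 𝔠.Cfar * ((𝔠.C25 * g * e) * (g ^ 7 * (r * pg) ^ 7)) := hfar
    _ = 𝔠.Cfar * 𝔠.C25 * e * (g * pg) ^ 7 * (g * r ^ 7) := by ring
    _ ≤ 𝔠.Cfar * 𝔠.C25 * e * (g * pg) ^ 7 * tlConst (7 * 𝔠.r₀) 1 := mul_le_mul_of_nonneg_left hT hc
    _ = 𝔠.Cfar * 𝔠.C25 * tlConst (7 * 𝔠.r₀) 1 * θBal F.L γ 𝔠.b₀ 𝔠.p₀ (K - b) ^ 7 * e := by rw [← heps]; ring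

/-- **THE STEP RECORD'S FAR TERMS IN THE RESIDUAL ROW'S CURRENCY AT THE BIRTH READING** (the 𝔖-half of the seventh-order residual row of ★w1 g0's `RemainderSmallOwnΦ`, `x = 1`):
for `b + 1 ≤ K`, every step-`b` domain `X`, history `h` and field `W`, with `n := K − b − 1` the height of the coarse field at the birth level `b + 1 = K − n`,
`|((q K).𝔖 b).far X h W| ≤ (Cfar·C25·tlConst(7r₀,1)·((√L)⁻¹(1 + log √L)^{p₀})⁷)·θBal F.L γ b₀ p₀ (K − b − 1)⁷·e^{−κ·dj X}` — `abs_stepFar_le_theta7_at` and `θ` one height up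
(`θBal_succ_pow_le`, window-free).  The constant depends on the record and `L` only. [cite: Balaban1985UV3, p.264 L14-20, (25) p.262, (5) p.256, (7) p.257, (57) p.270] -/
theorem abs_stepFar_le_theta7 (K b : ℕ) (hb : b + 1 ≤ K) (X : (tsys 3 (nblkOf (SK F 𝔠 γ hγ hγ1 K) 𝔠.lane.carrier b)).Dom)
    (h : Hist (F.P K) (b + 1)) (W : GaugeField (F.P K) (b + 1) (Matrix.specialUnitaryGroup (Fin 2) ℂ)) :
    |((q K).𝔖 b).far X h W| ≤
      (𝔠.Cfar * 𝔠.C25 * tlConst (7 * 𝔠.r₀) 1 * ((Real.sqrt F.L)⁻¹ * (1 + Real.log (Real.sqrt F.L)) ^ 𝔠.p₀) ^ 7) *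
        θBal F.L γ 𝔠.b₀ 𝔠.p₀ (K - b - 1) ^ 7 * Real.exp (-(𝔠.κ * (tsys 3 (nblkOf (SK F 𝔠 γ hγ hγ1 K) 𝔠.lane.carrier b)).dj X)) := by
  have hγ1' : γ ≤ 1 := hγ1.trans (sq_min_one_le _ 𝔠.gamma0_pos)
  have hup : θBal F.L γ 𝔠.b₀ 𝔠.p₀ (K - b) ^ 7 ≤
      ((Real.sqrt F.L)⁻¹ * (1 + Real.log (Real.sqrt F.L)) ^ 𝔠.p₀) ^ 7 * θBal F.L γ 𝔠.b₀ 𝔠.p₀ (K - b - 1) ^ 7 := by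
    rw [show K - b = (K - b - 1) + 1 by omega]
    exact θBal_succ_pow_le F.hL.2.le hγ hγ1' 𝔠.b₀_pos.le 𝔠.p₀_pos.le (K - b - 1) 7
  have hc : 0 ≤ 𝔠.Cfar * 𝔠.C25 * tlConst (7 * 𝔠.r₀) 1 := by
    have := 𝔠.Cfar_nonneg; have := 𝔠.C25_nonneg
    have := tlConst_nonneg (q := 7 * 𝔠.r₀) (c := 1) (by linarith [𝔠.one_le_r₀]) one_pos
    positivity
  have he : 0 ≤ Real.exp (-(𝔠.κ * (tsys 3 (nblkOf (SK F 𝔠 γ hγ hγ1 K) 𝔠.lane.carrier b)).dj X)) := (Real.exp_pos _).le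
  calc |((q K).𝔖 b).far X h W|
      ≤ 𝔠.Cfar * 𝔠.C25 * tlConst (7 * 𝔠.r₀) 1 * θBal F.L γ 𝔠.b₀ 𝔠.p₀ (K - b) ^ 7 *
          Real.exp (-(𝔠.κ * (tsys 3 (nblkOf (SK F 𝔠 γ hγ hγ1 K) 𝔠.lane.carrier b)).dj X)) := abs_stepFar_le_theta7_at q K b hb X h W
    _ ≤ 𝔠.Cfar * 𝔠.C25 * tlConst (7 * 𝔠.r₀) 1 *
          (((Real.sqrt F.L)⁻¹ * (1 + Real.log (Real.sqrt F.L)) ^ 𝔠.p₀) ^ 7 * θBal F.L γ 𝔠.b₀ 𝔠.p₀ (K - b - 1) ^ 7) *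
          Real.exp (-(𝔠.κ * (tsys 3 (nblkOf (SK F 𝔠 γ hγ hγ1 K) 𝔠.lane.carrier b)).dj X)) :=
        mul_le_mul_of_nonneg_right (mul_le_mul_of_nonneg_left hup hc) he
    _ = _ := by ring

end Far

end Summit.QuantumFields.YangMills.Theorems.GlobalSlackCanonicalPolymers

end
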